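import Literature.MathematicalPhysics.QuantumFieldTheory.ShenZhuZhuLogSobolev
import Mathlib.Analysis.Normed.Algebra.MatrixExponential
import Mathlib.Analysis.Calculus.IteratedDeriv.Defs
import HarnessLib

/-!
# The Bakry–Émery step of Shen–Zhu–Zhu's log-Sobolev theorem for `SU(N)` lattice Yang–Mills,
# with the Hessian constant as a parameter (CMP 400 (2023) 805–851, Theorem 4.2 / Cor. 4.4–4.5)

Shen–Zhu–Zhu prove their functional inequalities (Theorem 1.4 = Corollary 4.5, (1.9)–(1.10)) in two
separate steps (arXiv:2204.12737v1):

1. **Lemma 4.1** (p. 17, (4.2)): for every torus `Λ_L`, every configuration `Q ∈ SU(N)^{E⁺}` and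
   every tangent vector `v = XQ` (`X_e ∈ 𝔰𝔲(N)`), `|Hess_S(v,v)| ≤ 8(d-1)N|β| |v|²` for the Wilson
   action `S(Q) = Nβ Σ_p Re Tr Q_p`, `|v|² = Σ_e Tr(X_eX_e^*)` (Hilbert–Schmidt metric, §2); the
   number `8(d-1)` is a per-plaquette Cauchy–Schwarz count ("2 + 6", p. 18).
2. **Theorem 4.2 / Cor. 4.4 / Cor. 4.5** (p. 19–20): since `Ric(v,v) = ((N+2)/2 - 1)|v|² = (N/2)|v|²`
   on `SU(N)^{E⁺}` ([AGZ10, (F.6)], (4.8)), step 1 gives the Bakry–Émery condition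
   `Ric(v,v) - Hess_S(v,v) ≥ K_S |v|²` ((4.7)) with `K_S = N/2 - 8(d-1)N|β|`, and "by the Bakry–Émery
   criterion" ([BakryEmery1985]; [Wan06, Thm 5.6.1–5.6.2]) the finite-volume measures satisfy
   `LSI(2/K_S)` and Poincaré`(1/K_S)` uniformly in `L` (Cor. 4.4, (4.11)), hence so does every tight
   limit (Cor. 4.5, (4.12)–(4.13)).

Step 2 uses step 1 ONLY through the constant in (4.7). This file types step 2 AS PRINTED but with
the Hessian constant of step 1 as a parameter `Λ₀` (`shenZhuZhu_bakryEmery_transfer`): IF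
`|Hess_S(v,v)| ≤ Λ₀ N|β| |v|²` on every torus — phrased concretely as a bound on the second
derivative of `t ↦ Σ_p Re Tr hol_p(e^{tX}Q)` at `t = 0` (`WilsonHessianBound`; `t ↦ e^{tX}Q` is the
geodesic with initial velocity `v = XQ`, so this second derivative is `Hess(Σ_p Re Tr Q_p)(v,v)`) —
THEN the conclusions of Cor. 4.5 hold with `K = N/2 - N|β|Λ₀ > 0` in place of `K_S`, in the Lipschitz
form of `ShenZhuZhuLogSobolev.shenZhuZhu_functionalInequalities` (`SZZFunctionalInequalitiesWith`).
With `Λ₀ = 8(d-1)` this is literally Theorem 1.4 (`shenZhuZhu_functionalInequalities_of_transfer`);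
the venture `Summits/Ventures/YMGap` proves the hypothesis with `Λ₀ = 4d` (kernel-checked sharp
Hessian constant) and so obtains the window `|β| < 1/(8d)` conditionally on this named fact.

Not here: the proof (the general Bakry–Émery theorem on a compact Riemannian manifold,
`Ric + Hess(-log density) ≥ K ⇒ LSI(2/K)`, is not in the tree; the tree proves only the one-link
Poincaré inequality `SUNBakryEmery.haarPoincare_SU`); the `SO(N)` case; the `W₂`/ergodicity
statements (4.5)–(4.6) of Theorem 4.2.
-- TODO(general form): Bakry–Émery criterion on compact Riemannian manifolds
--   (Bakry–Émery 1985; Bakry–Gentil–Ledoux 2014, Prop. 5.7.1; F.-Y. Wang 2006, Thm 5.6.1).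

## References

* H. Shen, R. Zhu, X. Zhu, CMP 400 (2023) 805–851 = arXiv:2204.12737v1: Lemma 4.1 (4.2)–(4.4)
  p. 17–18; Theorem 4.2, (4.7)–(4.8) p. 19; Cor. 4.4 (4.11) p. 19; Cor. 4.5 (4.12)–(4.13) p. 20
  [ShenZhuZhuCMP2023].
* D. Bakry, M. Émery, *Diffusions hypercontractives*, LNM 1123 (1985) 177–206 [BakryEmery1985].
* D. Bakry, I. Gentil, M. Ledoux, Grundlehren 348 (2014) [BakryGentilLedoux2014].
-/

noncomputable section

open MeasureTheory ProbabilityTheory NormedSpace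
open scoped Matrix ContDiff
open Literature.MathematicalPhysics.QuantumLattice

namespace Literature.MathematicalPhysics.QuantumFieldTheory

variable {d N : ℕ}

/-- The squared Hilbert–Schmidt norm `|v|² = Σ_e Tr(X_e X_e^*)` of a tangent vector `v = XQ` to
`SU(N)^{E⁺(Λ_L)}` (Shen–Zhu–Zhu §2, p. 10–11: `⟨X,Y⟩ = Re Tr(XY^*)`, `|XQ|² = Tr(XX^*)`).
[cite: ShenZhuZhuCMP2023, §2] -/
def tangentSqNorm {L : ℕ} [NeZero L] (X : Edge d L → Matrix (Fin N) (Fin N) ℂ) : ℝ :=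
  ∑ e, (X e * (X e)ᴴ).trace.re

/-- The Wilson plaquette sum along the exponential curve through `U` with velocity `v = XU`:
`t ↦ Σ_p Re Tr( (e^{tX₁}U₁)(e^{tX₂}U₂)(e^{tX₃}U₃)^*(e^{tX₄}U₄)^* )`, the links of the plaquette
`p = (x; i<j)` taken in the order `U(x,i) U(x+eᵢ,j) U(x+eⱼ,i)⁻¹ U(x,j)⁻¹` of `plaquetteHolonomy`
(for unitary links `U⁻¹ = U^*`). Its value at `t = 0` is `Σ_p Re Tr U_p`, i.e. Shen–Zhu–Zhu's action
is `S = Nβ ·` (this at `t = 0`) ((1.1)/(4.1)), and `t ↦ e^{tX}U` is the geodesic of the bi-invariant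
metric with initial velocity `XU`, so the second derivative at `0` is `Hess(Σ_p Re Tr Q_p)(v,v)`
((4.3)). [cite: ShenZhuZhuCMP2023, (4.3)] -/
def wilsonPlaquetteSumAlong {L : ℕ} [NeZero L]
    (U : GaugeConfig d L (Matrix.specialUnitaryGroup (Fin N) ℂ))
    (X : Edge d L → Matrix (Fin N) (Fin N) ℂ) (t : ℝ) : ℝ :=
  ∑ p : Plaquette d L,
    (exp (t • X (p.1, p.2.1.1)) * (U (p.1, p.2.1.1) : Matrix (Fin N) (Fin N) ℂ)
      * (exp (t • X (p.1.shift p.2.1.1, p.2.1.2))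
          * (U (p.1.shift p.2.1.1, p.2.1.2) : Matrix (Fin N) (Fin N) ℂ))
      * (exp (t • X (p.1.shift p.2.1.2, p.2.1.1))
          * (U (p.1.shift p.2.1.2, p.2.1.1) : Matrix (Fin N) (Fin N) ℂ))ᴴ
      * (exp (t • X (p.1, p.2.1.2)) * (U (p.1, p.2.1.2) : Matrix (Fin N) (Fin N) ℂ))ᴴ).trace.re

variable (d N) in
/-- **Hessian bound with constant `Λ₀`** (the shape of Shen–Zhu–Zhu's Lemma 4.1, (4.2), with
`8(d-1)` replaced by a parameter): on every torus `Λ_L`, for every `Q ∈ SU(N)^{E⁺}` and every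
`X ∈ 𝔰𝔲(N)^{E⁺}` (skew-Hermitian, traceless),
`|d²/dt²|_{t=0} Σ_p Re Tr hol_p(e^{tX}Q)| ≤ Λ₀ Σ_e Tr(X_eX_e^*)`, i.e. `|Hess_S(v,v)| ≤ Λ₀ N|β| |v|²`
for `S = Nβ Σ_p Re Tr Q_p`. Lemma 4.1 asserts this with `Λ₀ = 8(d-1)`. [cite: ShenZhuZhuCMP2023, Lemma 4.1] -/
def WilsonHessianBound (Λ₀ : ℝ) : Prop :=
  ∀ (L : ℕ) [NeZero L] (U : GaugeConfig d L (Matrix.specialUnitaryGroup (Fin N) ℂ))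
    (X : Edge d L → Matrix (Fin N) (Fin N) ℂ),
    (∀ e, (X e)ᴴ = -X e) → (∀ e, (X e).trace = 0) →
      |iteratedDeriv 2 (wilsonPlaquetteSumAlong U X) 0| ≤ Λ₀ * tangentSqNorm X

/-- Monotonicity of the Hessian-bound hypothesis in the constant. [cite: ShenZhuZhuCMP2023, Lemma 4.1] -/
theorem WilsonHessianBound.mono {Λ₀ Λ₁ : ℝ} (h : WilsonHessianBound d N Λ₀) (hle : Λ₀ ≤ Λ₁) :
    WilsonHessianBound d N Λ₁ := by
  intro L _ U X hX hX0
  refine (h L U X hX hX0).trans (mul_le_mul_of_nonneg_right hle ?_)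
  unfold tangentSqNorm
  refine Finset.sum_nonneg fun e _ => ?_
  rw [Matrix.trace, Complex.re_sum]
  refine Finset.sum_nonneg fun i _ => ?_
  rw [Matrix.diag_apply, Matrix.mul_apply, Complex.re_sum]
  refine Finset.sum_nonneg fun j _ => ?_
  rw [Matrix.conjTranspose_apply, Complex.star_def, Complex.mul_conj, Complex.ofReal_re]
  exact Complex.normSq_nonneg _

-- From here on the Frobenius norm on matrices is in scope (as in `ShenZhuZhuLogSobolev`), for
-- `ContDiff` of cylinder functions; the definitions above deliberately avoid any matrix norm.
open scoped Matrix.Norms.Frobenius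

variable (d N) in
/-- The CONCLUSION of Shen–Zhu–Zhu's Corollary 4.5 ((4.12)–(4.13), Theorem 1.4 (1.9)–(1.10)) with
a general constant `K` in place of `K_S`, in the Lipschitz form of
`shenZhuZhu_functionalInequalities`: for every infinite-volume limit point `μ` of the torus `SU(N)`
Wilson states at tree coupling `Nβ` and every smooth cylinder function `F = f((U_e)_{e∈Λ})` that is
`L_e`-Lipschitz in the link `e` (Frobenius distance),
`Ent_μ(F²) ≤ (2/K) Σ_e L_e²` and `Var_μ(F) ≤ (1/K) Σ_e L_e²`. [cite: ShenZhuZhuCMP2023, Corollary 4.5] -/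
def SZZFunctionalInequalitiesWith (β K : ℝ) : Prop :=
  ∀ μ ∈ infiniteVolumeLimitPoints (d := d) (fundamentalRep (Fin N)) ((N : ℝ) * β),
    ∀ (Λ : Finset (ZdEdge d)) (f : (↥Λ → Matrix (Fin N) (Fin N) ℂ) → ℝ) (L : ↥Λ → ℝ),
      ContDiff ℝ ∞ f → (∀ e, 0 ≤ L e) →
      (∀ (e : ↥Λ) (M M' : ↥Λ → Matrix.specialUnitaryGroup (Fin N) ℂ),
        (∀ e', e' ≠ e → M e' = M' e') →
          |f (fun e' => (M e' : Matrix (Fin N) (Fin N) ℂ)) -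
              f (fun e' => (M' e' : Matrix (Fin N) (Fin N) ℂ))| ≤ L e * suFrobDist (M e) (M' e)) →
      (∫ U, matrixCylinder Λ f U ^ 2 * Real.log (matrixCylinder Λ f U ^ 2) ∂μ -
          (∫ U, matrixCylinder Λ f U ^ 2 ∂μ) * Real.log (∫ U, matrixCylinder Λ f U ^ 2 ∂μ)
            ≤ 2 / K * ∑ e, L e ^ 2) ∧
      (Var[matrixCylinder Λ f; μ] ≤ 1 / K * ∑ e, L e ^ 2)

/-- `shenZhuZhu_functionalInequalities` is, by definition, `SZZFunctionalInequalitiesWith` at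
`K = K_S = szzBakryEmeryConstSU N d β` for `|β| < 1/(16(d-1))`. [cite: ShenZhuZhuCMP2023, Theorem 1.4] -/
theorem shenZhuZhu_functionalInequalities_iff :
    shenZhuZhu_functionalInequalities d N ↔
      ∀ (_ : 2 ≤ d) (_ : 1 ≤ N) (β : ℝ), |β| < szzThresholdSU d →
        SZZFunctionalInequalitiesWith d N β (szzBakryEmeryConstSU N d β) :=
  Iff.rfl

variable (d N) in
/-- **Shen–Zhu–Zhu's Bakry–Émery step, Hessian constant as a parameter** (CMP 400 (2023), proof of
Theorem 4.2 via (4.7)–(4.8), Cor. 4.4 (4.11), Cor. 4.5 (4.12)–(4.13); the criterion itself is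
Bakry–Émery 1985, used through [Wan06, Thm 5.6.1–5.6.2]). On `SU(N)^{E⁺(Λ_L)}` with the
Hilbert–Schmidt bi-invariant metric, `Ric(v,v) = (N/2)|v|²` ((4.8)); if the Wilson action
`S = Nβ Σ_p Re Tr Q_p` satisfies `|Hess_S(v,v)| ≤ Λ₀N|β| |v|²` on every torus
(`WilsonHessianBound d N Λ₀`), then `Ric - Hess_S ≥ K := N/2 - N|β|Λ₀` ((4.7) with this constant)
and, when `K > 0`, the finite-volume measures `μ_{Λ_L,N,β} ∝ exp(S) ∏ dQ_e` satisfy `LSI(2/K)` and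
Poincaré`(1/K)` uniformly in `L`, hence every tight (infinite-volume) limit satisfies
(4.12)–(4.13) with `K`: `SZZFunctionalInequalitiesWith d N β K`. As printed the theorem is the case
`Λ₀ = 8(d-1)` supplied by Lemma 4.1 (`shenZhuZhu_functionalInequalities_of_transfer`); the proof
uses Lemma 4.1 only through the constant in (4.7). [cite: ShenZhuZhuCMP2023, Theorem 4.2] -/
def shenZhuZhu_bakryEmery_transfer : Prop :=
  ∀ (Λ₀ : ℝ), 0 ≤ Λ₀ → WilsonHessianBound d N Λ₀ →
    ∀ (_ : 2 ≤ d) (_ : 1 ≤ N) (β : ℝ), 0 < (N : ℝ) / 2 - N * |β| * Λ₀ →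
      SZZFunctionalInequalitiesWith d N β ((N : ℝ) / 2 - N * |β| * Λ₀)

/-- `K_S = (N+2)/2 - 1 - 8N|β|(d-1)` is the transfer constant `N/2 - N|β|Λ₀` at `Λ₀ = 8(d-1)`.
[cite: ShenZhuZhuCMP2023, Assumption 1.1] -/
theorem szzBakryEmeryConstSU_eq_transfer (N d : ℕ) (β : ℝ) :
    szzBakryEmeryConstSU N d β = (N : ℝ) / 2 - N * |β| * (8 * ((d : ℝ) - 1)) := by
  unfold szzBakryEmeryConstSU
  ring

/-- **Consistency with the printed theorem**: the transfer fact together with the Hessian bound of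
Lemma 4.1 (`Λ₀ = 8(d-1)`) yields exactly `shenZhuZhu_functionalInequalities` (Theorem 1.4 in the
tree's Lipschitz form). [cite: ShenZhuZhuCMP2023, Theorem 4.2] -/
theorem shenZhuZhu_functionalInequalities_of_transfer (h : shenZhuZhu_bakryEmery_transfer d N)
    (hH : WilsonHessianBound d N (8 * ((d : ℝ) - 1))) : shenZhuZhu_functionalInequalities d N := by
  intro hd hN β hβ
  have hd' : (2 : ℝ) ≤ d := by exact_mod_cast hd
  have hΛ : (0 : ℝ) ≤ 8 * ((d : ℝ) - 1) := by nlinarith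
  have hK : 0 < (N : ℝ) / 2 - N * |β| * (8 * ((d : ℝ) - 1)) := by
    rw [← szzBakryEmeryConstSU_eq_transfer]
    exact (szzBakryEmeryConstSU_pos_iff hd hN β).2 hβ
  have key := h _ hΛ hH hd hN β hK
  rw [← szzBakryEmeryConstSU_eq_transfer] at key
  exact key

end Literature.MathematicalPhysics.QuantumFieldTheory
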